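import Summits.AtomisticToContinuum.FouriersLaw.Theorems.OddSectorIrreversibilityResponseDensityLinearResponse
import Summits.AtomisticToContinuum.FouriersLaw.Theorems.OddSectorIrreversibilityResponseDensityKernelContinuity
import Summits.AtomisticToContinuum.FouriersLaw.Theorems.EmbeddedDrudeMourreAbelThermodynamicLimitAnchoredKuboResponse
import HarnessLib

/-!
# `stub_anchoredKubo` of line `loomis-compact-horizon-witness`, part 5: from `δ`-uniform mixing
(crux `EmbeddedDrudeMourre.AbelThermodynamicLimit`, item stmt-AtomisticToContinuum-12596;
`--supports` helper file for the registered stub S3 `stub_anchoredKubo`, closes nothing)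

Part 4 reduced conjunct (2) of S3 (`T² Dn N = Σ_k ∫₀^∞ ⟨j_c(0) j_k(t)⟩_{N,T} dt`) to the bare per-bond
linear response in Kubo form. This file pins that response on ONE analytic hypothesis, the
`δ`-UNIFORM form of the exponential convergence CEHR (2.5) of the two-temperature semigroups with baths
at `T ± δ/2` (Harris' theorem with Lyapunov/minorisation constants uniform for bath temperatures in a
compact set — the hypothesis `hUM` of `pinnedChain_linear_response_of_uniformMixing` in the
`ResponseDensity` files, stmt-9144), using the PROVED continuity of the forecasts in the temperatures
(`pinnedChain_tendsto_integral_kernel_temps`) and the PROVED identification of the weak steady states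
with the semigroup's invariant measures under uniqueness (`isInvariant_of_isSteadyState_of_unique`):

* `kuboResponse_value_eq` — the limit value of `pinnedChain_linear_response_of_uniformMixing`
  (Lebesgue form, weight `e^{-H/T}`/partition function) is `∫₀^∞ ∫ g · P_s φ dμ_T ds`,
  `g = γ(p_0² - p_{N-1}²)/(2T²)`;
* `stub_anchoredKuboOfUniformMixing` (registered sub-goal): S3's hypotheses + `δ`-uniform mixing at
  `(N, T)` ⇒ S3's conclusion. So `stub_anchoredKubo` follows BY NAME from a proof of `δ`-uniform CEHR
  (2.5) mixing alone (its genuine analytic core), independently of the closing of stmt-9144/9146.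

References: Cuneo–Eckmann–Hairer–Rey-Bellet 2018 Thm 2.13 (3); Hairer–Majda 2009 Thm 2.3;
Rey-Bellet 2003 Rem. 4.4; Kundu–Dhar–Narayan 2009 eqs. (8)–(15).
-/

noncomputable section

open MeasureTheory ProbabilityTheory Filter Topology Set Function
open scoped NNReal ENNReal ContDiff

namespace Summit.AtomisticToContinuum.FouriersLaw.Theorems.AbelThermodynamicLimit.LoomisCompactHorizonWitness

open Literature.MathematicalPhysics.KineticTheory.HeatConduction
open Literature.MathematicalPhysics.KineticTheory OscillatorChain
open Summit.AtomisticToContinuum.FouriersLaw.Theorems.SubdiffusiveBondHeat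
open Summit.AtomisticToContinuum.FouriersLaw.Theorems.LightConeBondHeat
open Summit.AtomisticToContinuum.FouriersLaw.Theorems.OddSectorIrreversibility
open Summit.AtomisticToContinuum.FouriersLaw.Theorems.OddSectorIrreversibility.Corrector

variable {N : ℕ}

/-- **The Kubo response value, Lebesgue form = Gibbs form.** For every observable `φ`:
`(γ/2T²) (∫ e^{-H/T})⁻¹ ∫₀^∞ ∫ P_s φ · e^{-H/T}(p_0² - p_{N-1}²) dx ds = ∫₀^∞ ∫ g · P_s φ dμ_T ds` with
`g = γ(p_0² - p_{N-1}²)/(2T²)` and `μ_T = gibbsMeasure N T` (pure bookkeeping: `μ_T` has Lebesgue density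
`e^{-H/T}/∫ e^{-H/T}`). [folklore] -/
theorem kuboResponse_value_eq (P : OscillatorChain) (hN : 0 < N) (T γ' : ℝ) (φ : PhaseSpace N → ℝ)
    (κ : ℝ → PhaseSpace N → Measure (PhaseSpace N)) :
    (γ' / (2 * T ^ 2)) / (∫ x, Real.exp (-1 / T * P.hamiltonian N x)) *
        ∫ s in Ioi (0 : ℝ), ∫ x, (∫ y, φ y ∂(κ s x)) *
          (Real.exp (-1 / T * P.hamiltonian N x) * (x.2 ⟨0, hN⟩ ^ 2 - x.2 ⟨N - 1, by omega⟩ ^ 2)) =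
      ∫ s in Ioi (0 : ℝ), ∫ x, γ' / (2 * T ^ 2) * (x.2 ⟨0, hN⟩ ^ 2 - x.2 ⟨N - 1, by omega⟩ ^ 2) *
          (∫ y, φ y ∂(κ s x)) ∂(P.gibbsMeasure N T) := by
  have hρ : ∀ x : PhaseSpace N, Real.exp (-1 / T * P.hamiltonian N x) = P.gibbsDensity N T x := by
    intro x
    rw [OscillatorChain.gibbsDensity]
    congr 1
    ring
  simp only [hρ]
  rw [← integral_const_mul]
  refine integral_congr_ae (Eventually.of_forall fun s => ?_)
  dsimp only
  rw [P.integral_gibbsMeasure, ← integral_const_mul, ← integral_const_mul]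
  refine integral_congr_ae (Eventually.of_forall fun x => ?_)
  dsimp only
  rw [div_eq_mul_inv (γ' / (2 * T ^ 2))]
  ring

/-- **Registered sub-goal `stub_anchoredKuboOfUniformMixing`.** The hypotheses of the registered stub
S3 `stub_anchoredKubo`, plus — at the given `N ≥ 2` and `T` — the `δ`-UNIFORM exponential convergence
CEHR (2.5) of the transition semigroups with baths at `T ± δ/2` to their invariant probability
measures (`|P^{(δ)}_t f(z) - ν(f)| ≤ C_m e^{ϑH(z)} e^{-ct}` for continuous `|f| ≤ e^{ϑH}`, with
`δ₀, ϑ, C_m, c` independent of `|δ| < δ₀`), imply S3's conclusion: under uniqueness each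
`μ N (T+δ/2) (T-δ/2)` is the semigroup's invariant probability measure, the forecasts of the bond
currents are continuous in `δ` (`pinnedChain_tendsto_integral_kernel_temps`), so
`pinnedChain_linear_response_of_uniformMixing` gives the per-bond response in Kubo form, and part 4
(`stub_anchoredKuboOfKuboResponse`) concludes.
[cite: CuneoEckmannHairerReyBellet2018, Thm 2.13 (3)] [cite: KunduDharNarayan2009, eqs. (8)–(15)] -/
theorem stub_anchoredKuboOfUniformMixing :
    ∀ ω₂ lam β γ : ℝ, 0 < ω₂ → 0 < lam → 0 < β → 0 < γ →
      (∀ (N : ℕ) (T_L T_R : ℝ), 0 < T_L → 0 < T_R →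
        ∀ μ ν : MeasureTheory.Measure (Literature.MathematicalPhysics.KineticTheory.HeatConduction.PhaseSpace N),
          (Literature.MathematicalPhysics.KineticTheory.HeatConduction.pinnedChain ω₂ lam β γ).IsSteadyState N T_L T_R μ →
          (Literature.MathematicalPhysics.KineticTheory.HeatConduction.pinnedChain ω₂ lam β γ).IsSteadyState N T_L T_R ν → μ = ν) →
      ∀ T : ℝ, 0 < T →
      ∀ (μ : (N : ℕ) → ℝ → ℝ → MeasureTheory.Measure (Literature.MathematicalPhysics.KineticTheory.HeatConduction.PhaseSpace N)) (Dn : ℕ → ℝ),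
        (∀ (N : ℕ) (T_L T_R : ℝ), 0 < T_L → 0 < T_R →
          (Literature.MathematicalPhysics.KineticTheory.HeatConduction.pinnedChain ω₂ lam β γ).IsSteadyState N T_L T_R (μ N T_L T_R)) →
        (∀ N : ℕ, Filter.Tendsto (fun δ : ℝ =>
            (Literature.MathematicalPhysics.KineticTheory.HeatConduction.pinnedChain ω₂ lam β γ).totalCurrent (μ N (T + δ / 2) (T - δ / 2)) / δ)
          (nhdsWithin 0 {(0 : ℝ)}ᶜ) (nhds (Dn N))) →
        ∀ (N : ℕ) (hN : 2 ≤ N),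
          (∃ δ₀ ϑ Cm c : ℝ, 0 < δ₀ ∧ δ₀ < 2 * T ∧ 0 < ϑ ∧ ϑ < 1 / (T + δ₀ / 2) ∧ 0 ≤ Cm ∧ 0 < c ∧
            ∀ δ : ℝ, |δ| < δ₀ → ∀ ν : MeasureTheory.Measure (Literature.MathematicalPhysics.KineticTheory.HeatConduction.PhaseSpace N),
              MeasureTheory.IsProbabilityMeasure ν →
              (∀ t : NNReal, ν.bind ((Literature.MathematicalPhysics.KineticTheory.HeatConduction.pinnedChain ω₂ lam β γ).transitionKernel N (T + δ / 2) (T - δ / 2) t) = ν) →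
              ∀ (z : Literature.MathematicalPhysics.KineticTheory.HeatConduction.PhaseSpace N) (t : NNReal) (f : Literature.MathematicalPhysics.KineticTheory.HeatConduction.PhaseSpace N → ℝ), Continuous f →
                (∀ y, |f y| ≤ Real.exp (ϑ * (Literature.MathematicalPhysics.KineticTheory.HeatConduction.pinnedChain ω₂ lam β γ).hamiltonian N y)) →
                |(∫ y, f y ∂((Literature.MathematicalPhysics.KineticTheory.HeatConduction.pinnedChain ω₂ lam β γ).transitionKernel N (T + δ / 2) (T - δ / 2) t z)) -
                    ∫ y, f y ∂ν| ≤
                  Cm * Real.exp (ϑ * (Literature.MathematicalPhysics.KineticTheory.HeatConduction.pinnedChain ω₂ lam β γ).hamiltonian N z) * Real.exp (-c * t)) →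
          (∀ i k : Fin N, MeasureTheory.IntegrableOn (fun t : ℝ =>
              ∫ z, (Literature.MathematicalPhysics.KineticTheory.HeatConduction.pinnedChain ω₂ lam β γ).bondCurrent N i z *
                (∫ y, (Literature.MathematicalPhysics.KineticTheory.HeatConduction.pinnedChain ω₂ lam β γ).bondCurrent N k y
                  ∂((Literature.MathematicalPhysics.KineticTheory.HeatConduction.pinnedChain ω₂ lam β γ).transitionKernel N T T t.toNNReal z))
              ∂((Literature.MathematicalPhysics.KineticTheory.HeatConduction.pinnedChain ω₂ lam β γ).gibbsMeasure N T)) (Set.Ioi 0)) ∧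
          T ^ 2 * Dn N = ∑ k : Fin N, ∫ t in Set.Ioi (0 : ℝ),
              ∫ z, (Literature.MathematicalPhysics.KineticTheory.HeatConduction.pinnedChain ω₂ lam β γ).bondCurrent N ⟨(N - 1) / 2, by omega⟩ z *
                (∫ y, (Literature.MathematicalPhysics.KineticTheory.HeatConduction.pinnedChain ω₂ lam β γ).bondCurrent N k y
                  ∂((Literature.MathematicalPhysics.KineticTheory.HeatConduction.pinnedChain ω₂ lam β γ).transitionKernel N T T t.toNNReal z))
              ∂((Literature.MathematicalPhysics.KineticTheory.HeatConduction.pinnedChain ω₂ lam β γ).gibbsMeasure N T) := by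
  intro ω₂ lam β γ hω hl hβ hγ hU T hT μ Dn hμ hDn N hN hUM
  obtain ⟨δ₀, ϑ, Cm, c, hδ₀, hδ₀T, hϑ, hϑT, hCm, hc, hUM⟩ := hUM
  have hN0 : 0 < N := by omega
  refine stub_anchoredKuboOfKuboResponse ω₂ lam β γ hω hl hβ hγ hU T hT μ Dn hμ hDn N hN fun i => ?_
  set P := pinnedChain ω₂ lam β γ with hP
  -- the bond current is an admissible observable
  have hV : ContDiff ℝ ∞ P.V := pinnedChain_contDiff_V ω₂ lam β γ
  have hj2 : ContDiff ℝ 2 (fun x => P.bondCurrent N i x) := (contDiff_bondCurrent P hV N i).of_le (by norm_cast)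
  have hjb := pinnedChain_abs_bondCurrent_le_exp hω.le hl.le hβ.le γ N hϑ i
  -- continuity of the forecasts in `δ` (with the auxiliary exponent `1/(4T)`)
  obtain ⟨hθ0, h2θ⟩ := quarter_inv_temp_admissible hT
  have hCONT : ∀ (s : ℝ≥0) (x : PhaseSpace N), Tendsto (fun δ : ℝ => ∫ y, P.bondCurrent N i y
      ∂(P.transitionKernel N (T + δ / 2) (T - δ / 2) s x)) (𝓝 0)
      (𝓝 (∫ y, P.bondCurrent N i y ∂(P.transitionKernel N T T s x))) := fun s x =>
    pinnedChain_tendsto_integral_kernel_temps hω hl.le hβ.le hγ hN0 hT hθ0 h2θ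
      (pinnedChain_continuous_bondCurrent ω₂ lam β γ N i)
      (pinnedChain_abs_bondCurrent_le_exp hω.le hl.le hβ.le γ N hθ0 i) s x
  -- the family: probability and invariance (under uniqueness the steady state is the invariant law)
  have hfacts : ∀ δ : ℝ, |δ| < δ₀ → 0 < T + δ / 2 ∧ 0 < T - δ / 2 := fun δ hδ =>
    ⟨(bath_facts_of_abs_lt hδ₀T hϑT hδ).1, (bath_facts_of_abs_lt hδ₀T hϑT hδ).2.1⟩
  have hμP : ∀ δ : ℝ, |δ| < δ₀ → IsProbabilityMeasure (μ N (T + δ / 2) (T - δ / 2)) := fun δ hδ =>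
    (hμ N _ _ (hfacts δ hδ).1 (hfacts δ hδ).2).1
  have hμI : ∀ δ : ℝ, |δ| < δ₀ → ∀ t : ℝ≥0,
      (μ N (T + δ / 2) (T - δ / 2)).bind (P.transitionKernel N (T + δ / 2) (T - δ / 2) t) =
        μ N (T + δ / 2) (T - δ / 2) := by
    intro δ hδ t
    obtain ⟨hL, hR⟩ := hfacts δ hδ
    exact (FiniteResponse.isInvariant_of_isSteadyState_of_unique hω hl.le hβ hγ hN0 hL hR (hU N _ _ hL hR)
      (hμ N _ _ hL hR)) t
  have h := pinnedChain_linear_response_of_uniformMixing hω hl.le hβ hγ hN0 hT hδ₀ hδ₀T hϑ hϑT hj2 hjb hCm hc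
    hUM hCONT (fun δ => μ N (T + δ / 2) (T - δ / 2)) hμP hμI
  simp only [zero_div, add_zero, sub_zero] at h
  rw [kuboResponse_value_eq P hN0 T γ (fun x => P.bondCurrent N i x)
    (fun s x => (P.transitionKernel N T T s.toNNReal x : Measure (PhaseSpace N)))] at h
  exact h

end Summit.AtomisticToContinuum.FouriersLaw.Theorems.AbelThermodynamicLimit.LoomisCompactHorizonWitness

end
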